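import Summits.Ventures.YMGap.BEDoor.Curvature
import Literature.Geometry.Lorentzian.ConstraintFamilies

/-!
# BEDoor / QuasiLocal — §4c THE QUASI-LOCAL DOOR (polynomial S)
# (module 04/11 of the Bakry–Émery door, LIFT edition v8.3 = parts `QuasiLocal` (v8.2 module 06); cell `ym-beyond`, seat P4)

HONEST FRAMING (cell `ym-beyond`, seat P4 «Hessian-currency receiver», lens Y2; HUMAN RULINGS D-0035 / D-0037; memo `HOME/ROUTE-P4Y2.md` v8.1 +
g10 addendum, spec `HOME/ROUTE-P4Y2-LIFT-SPEC-v83.md`; LIFT edition v8.3 = the v8.2 module bodies of `HOME/ROUTE-P4Y2-Sketch.lean` v8.1, byte-identical and in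
order, re-packed into 11 ≤ 400-line modules (fewer olean round-trips; director-ym line №2 (B)); the g10 appendix `OpenStrip` is a separate, UNQUEUED HOME file (line №3 (D))).  FINITE-LATTICE
statements at STRONG effective coupling: a RECEIVER («door») in HESSIAN (Bakry–Émery) currency for renormalisation-group output, typed over the
tree's generic clustering chain `Thresholds/SharpClustering*` + `Thresholds/LatticeBakryEmery*`, complementary to the Dobrushin-currency door
`YM4Door/*` (LITERALLY the same INPUT predicate `QuasiLocalGaugePerturbation.HasAnalyticNormLE … stripDomain`, the same OUTPUT predicate
`RobustBall.ClustersWith`; no residual hypothesis: Osgood regularity is the tree's `Literature.Analysis.Complex.SCV.contDiffOn_infty`,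
part `Osgood` of module `AnalyticStrip`).  Nothing here is a statement about `β → ∞`, the continuum limit or the Clay problem; NO effective action is asserted to be at
the door (that INPUT is not in print for `d = 4`); the verdict «the two windows do not meet» is unchanged in this currency.
WHAT THIS IS NOT (ladder rung R2d; director-ym line №2 (B)): every door of this LIFT is an entry on the STRONG-COUPLING BANK of THE NUMBER —
finite-lattice exponential clustering at SMALL `|β|` and small strip norm `η` of the perturbation (`SU(2)`, `d = 4`: `16.2|β| + 4.4η < 1`, module `SU2`,
conclusion literally `RobustBall.ClustersWith`) — NOT clustering at weak coupling, NOT a statement at large `β`, NOT the mass gap.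
No conjecture name, no `sorry`, no axiom beyond the standard three; every theorem is bookkeeping over the tree. [folklore]
References: H. Shen, R. Zhu, X. Zhu, CMP 400 (2023) 805 (arXiv:2204.12737) Thm 1.2, Cor. 4.4/4.11; D. Bakry, M. Émery, LNM 1123 (1985);
T. Bałaban, CMP 109 (1987) 249, (1.18)–(1.22) (analyticity format); L. Hörmander, An Introduction to Complex Analysis in Several Variables
(1973) Thm 2.2.1/2.2.6 (Osgood); E. J. McShane, Bull. AMS 40 (1934) 837 (Lipschitz extension).

THIS MODULE, part `QuasiLocal` (§4c THE QUASI-LOCAL DOOR (polynomial S)): `cov_decay_quasilocal` (generic link set: ANY-range `h`, ANY `D : links →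
ℕ`, any rate `κ ≥ 0`, profile constant `Θ ≥ Σ_{e'} h e e'(e^{κ|D e − D e'|} − 1)`, door `N/2 − Λ − Θ > 0`); torus `beDoorQL_abs_le` /
`beDoorQL_gibbsCov_le` for `S = wilsonPot β + R`; `beDoorQL_window_su2_d4` (`β_W,eff(8 + 9(e^κ − 1)) + Λ_R + Θ_R(κ) < 1`).
-/

noncomputable section

open scoped Matrix ComplexConjugate BigOperators Matrix.Norms.Frobenius ContDiff Topology
open Matrix Complex Finset MeasureTheory Filter
open Literature.MathematicalPhysics.QuantumFieldTheory
open Literature.MathematicalPhysics.QuantumFieldTheory.SUNBakryEmery (SUN FrameIdx frame)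

namespace Summit.Ventures.YMGap.BEDoor

open Summit.Ventures.YMGap Summit.Ventures.YMGap.LatticeBakryEmery Summit.Ventures.YMGap.SharpClustering
open Summit.Ventures.YMGap.HessianSharp

universe u

/-! ## §4c ★★ THE QUASI-LOCAL DOOR: exponential clustering for ANY-range interactions with an exponential profile
(the tree's `cov_exp_decay_of_distFun` bookkeeping run on `covariance_le_theta` with weights `w = e^{2κD}`). -/

section QuasiLocal

-- `|exp t − 1| ≤ exp |t| − 1` is the tree's `Literature.Geometry.Lorentzian.Deformation.abs_exp_sub_one_le_exp_abs_sub_one`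
-- (reused per the gate's dedup rule; the cell sketch's local copy `abs_exp_sub_one_le` is not re-declared).

/-- The `θ`-factor of exponential weights: `|√(e^{2κa}/e^{2κb}) − 1| ≤ e^{κ|a−b|} − 1` (`κ ≥ 0`). [folklore] -/
theorem theta_exp_le {κ : ℝ} (hκ : 0 ≤ κ) (a b : ℝ) :
    |Real.sqrt (Real.exp (2 * κ * a) / Real.exp (2 * κ * b)) - 1| ≤ Real.exp (κ * |a - b|) - 1 := by
  have h1 : Real.sqrt (Real.exp (2 * κ * a) / Real.exp (2 * κ * b)) = Real.exp (κ * a - κ * b) := by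
    rw [← Real.exp_sub, show 2 * κ * a - 2 * κ * b = (κ * a - κ * b) + (κ * a - κ * b) by ring, Real.exp_add,
      Real.sqrt_mul_self (Real.exp_pos _).le]
  rw [h1, show κ * |a - b| = |κ * a - κ * b| by rw [← mul_sub, abs_mul, abs_of_nonneg hκ]]
  exact Literature.Geometry.Lorentzian.Deformation.abs_exp_sub_one_le_exp_abs_sub_one _

variable {ι : Type u} [Fintype ι] [DecidableEq ι] {N : ℕ}

/-- ★★ **QUASI-LOCAL EXPONENTIAL CLUSTERING (generic link set, unconditional).**  Polynomial `S` on `SU(N)^ι` with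
`HessBound S Λ` and `OffDiagHessBound S h`, `h ≥ 0` symmetric of ANY RANGE; `D : ι → ℕ` ANY function ("distance from the
support of `v`"), `κ ≥ 0`, and the PROFILE CONSTANT `Θ ≥ Σ_{e'} h e e'·(e^{κ|D e − D e'|} − 1)` for every `e`; door
`K := N/2 − Λ − Θ > 0`.  Then for smooth per-link-Lipschitz `u, v` (`δv ≠ 0 ⇒ D = 0`, `δu ≠ 0 ⇒ D ≥ m`):
`|Z ∫ e^S uv − ∫ e^S u ∫ e^S v| ≤ Z²·e^{−κ m}·(Σδu)(Σδv)/K`.  For a finite-range `h` (tree case) `Θ ≤ (e^κ − 1)·H`;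
for `h e e' ≤ A e^{−κ₀·dist}` and `D` = graph distance, `Θ < ∞` for every `κ < κ₀` — the RG-remainder shape. [folklore] -/
theorem cov_decay_quasilocal (hN : N ≠ 0) {dS : ℕ} {S : Cfg ι N → ℝ} (hSp : S ∈ polySpace ι N dS)
    {Λ : ℝ} (hHess : HessBound S Λ) {h : ι → ι → ℝ} (hOff : OffDiagHessBound S h) (hh0 : ∀ e e', 0 ≤ h e e')
    (hsymm : ∀ e e', h e e' = h e' e) (D : ι → ℕ) {κ Θ : ℝ} (hκ : 0 ≤ κ)
    (hΘ : ∀ e, ∑ e', h e e' * (Real.exp (κ * |(D e : ℝ) - D e'|) - 1) ≤ Θ)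
    (hK : 0 < (N : ℝ) / 2 - Λ - Θ)
    {u v : Cfg ι N → ℝ} (hu : ContDiff ℝ ∞ u) (hv : ContDiff ℝ ∞ v)
    {δu δv : ι → ℝ} (hδu : ∀ e, 0 ≤ δu e) (hδv : ∀ e, 0 ≤ δv e)
    (hLu : LinkLipschitz u δu) (hLv : LinkLipschitz v δv)
    (hDv : ∀ e, δv e ≠ 0 → D e = 0) {m : ℕ} (hDu : ∀ e, δu e ≠ 0 → m ≤ D e) :
    |(∫ x : PSU ι N, Real.exp (S (emb x)) ∂(haarPi ι N)) *
          (∫ x : PSU ι N, Real.exp (S (emb x)) * (u (emb x) * v (emb x)) ∂(haarPi ι N)) -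
        (∫ x : PSU ι N, Real.exp (S (emb x)) * u (emb x) ∂(haarPi ι N)) *
          (∫ x : PSU ι N, Real.exp (S (emb x)) * v (emb x) ∂(haarPi ι N))| ≤
      (∫ x : PSU ι N, Real.exp (S (emb x)) ∂(haarPi ι N)) ^ 2 *
        (Real.exp (-κ * m) * (∑ e, δu e) * (∑ e, δv e)) / ((N : ℝ) / 2 - Λ - Θ) := by
  set K : ℝ := (N : ℝ) / 2 - Λ - Θ with hKdef
  have hS : ContDiff ℝ ∞ S := contDiff_of_mem_polySpace hSp
  set w : ι → ℝ := fun e => Real.exp (2 * κ * D e) with hw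
  have hwpos : ∀ e, 0 < w e := fun e => Real.exp_pos _
  have hw0 : ∀ e, 0 ≤ w e := fun e => (hwpos e).le
  have hθ : ∀ e e', h e e' * |Real.sqrt (w e / w e') - 1| ≤ h e e' * (Real.exp (κ * |(D e : ℝ) - D e'|) - 1) :=
    fun e e' => mul_le_mul_of_nonneg_left (theta_exp_le hκ _ _) (hh0 e e')
  have hrow : ∀ e, ∑ e', h e e' * |Real.sqrt (w e / w e') - 1| ≤ Θ := fun e =>
    (sum_le_sum fun e' _ => hθ e e').trans (hΘ e)
  have hcol : ∀ e', ∑ e, h e e' * |Real.sqrt (w e / w e') - 1| ≤ Θ := fun e' => by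
    refine (sum_le_sum fun e _ => hθ e e').trans ?_
    have : ∑ e, h e e' * (Real.exp (κ * |(D e : ℝ) - D e'|) - 1) =
        ∑ e, h e' e * (Real.exp (κ * |(D e' : ℝ) - D e|) - 1) :=
      sum_congr rfl fun e _ => by rw [hsymm e e', abs_sub_comm]
    rw [this]
    exact hΘ e'
  have hmain := covariance_le_theta hN hSp hHess hOff hh0 hwpos hrow hcol hK hu hv
  -- gradient bounds (verbatim from the tree)
  have hGu : ∀ g : PSU ι N, GamW (fun e => (w e)⁻¹) u u (emb g) ≤ Real.exp (-(2 * κ * m)) * (∑ e, δu e) ^ 2 := by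
    intro g
    refine GamW_le_mul_sq_sum hN (fun e => inv_nonneg.2 (hw0 e)) hu hδu hLu (Real.exp_pos _).le
      (fun e he => ?_) g
    rw [← Real.exp_neg]
    refine Real.exp_le_exp.2 ?_
    have : (m : ℝ) ≤ D e := by exact_mod_cast hDu e he
    nlinarith [hκ]
  have hGv : ∀ g : PSU ι N, GamW w v v (emb g) ≤ 1 * (∑ e, δv e) ^ 2 := by
    intro g
    refine GamW_le_mul_sq_sum hN hw0 hv hδv hLv zero_le_one (fun e he => ?_) g
    show Real.exp (2 * κ * D e) ≤ 1
    rw [hDv e he, Nat.cast_zero, mul_zero, Real.exp_zero]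
  set Z : ℝ := ∫ U, Real.exp (S (emb U)) ∂(haarPi ι N) with hZ
  have hSc : Continuous fun U : PSU ι N => S (emb U) := continuous_restrict hS
  have hEc : Continuous fun U : PSU ι N => Real.exp (S (emb U)) := Real.continuous_exp.comp hSc
  have hZpos : 0 < Z := integral_exp_pos (integrable_of_continuous_PSU hEc _)
  have hIu : ∫ U, Real.exp (S (emb U)) * GamW (fun e => (w e)⁻¹) u u (emb U) ∂(haarPi ι N) ≤
      Z * (Real.exp (-(2 * κ * m)) * (∑ e, δu e) ^ 2) := by
    rw [hZ, ← integral_mul_const]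
    refine integral_mono (integrable_of_continuous_PSU (hEc.mul (continuous_restrict (contDiff_GamW _ hu hu))) _)
      ((integrable_of_continuous_PSU hEc _).mul_const _) fun U => ?_
    exact mul_le_mul_of_nonneg_left (hGu U) (Real.exp_pos _).le
  have hIv : ∫ U, Real.exp (S (emb U)) * GamW w v v (emb U) ∂(haarPi ι N) ≤ Z * (1 * (∑ e, δv e) ^ 2) := by
    rw [hZ, ← integral_mul_const]
    refine integral_mono (integrable_of_continuous_PSU (hEc.mul (continuous_restrict (contDiff_GamW _ hv hv))) _)
      ((integrable_of_continuous_PSU hEc _).mul_const _) fun U => ?_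
    exact mul_le_mul_of_nonneg_left (hGv U) (Real.exp_pos _).le
  have hsu : 0 ≤ ∑ e, δu e := sum_nonneg fun e _ => hδu e
  have hsv : 0 ≤ ∑ e, δv e := sum_nonneg fun e _ => hδv e
  have hsqu : Real.sqrt (∫ U, Real.exp (S (emb U)) * GamW (fun e => (w e)⁻¹) u u (emb U) ∂(haarPi ι N)) ≤
      Real.sqrt Z * (Real.exp (-(κ * m)) * ∑ e, δu e) := by
    refine (Real.sqrt_le_sqrt hIu).trans (le_of_eq ?_)
    have e1 : Real.exp (-(2 * κ * m)) = Real.exp (-(κ * m)) ^ 2 := by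
      rw [← Real.exp_nat_mul]; congr 1; push_cast; ring
    rw [e1, ← mul_pow, Real.sqrt_mul hZpos.le, Real.sqrt_sq (mul_nonneg (Real.exp_pos _).le hsu)]
  have hsqv : Real.sqrt (∫ U, Real.exp (S (emb U)) * GamW w v v (emb U) ∂(haarPi ι N)) ≤
      Real.sqrt Z * ∑ e, δv e := by
    refine (Real.sqrt_le_sqrt hIv).trans (le_of_eq ?_)
    rw [one_mul, Real.sqrt_mul hZpos.le, Real.sqrt_sq hsv]
  set Cu : ℝ := Z * (∫ U, Real.exp (S (emb U)) * (u (emb U) * v (emb U)) ∂(haarPi ι N)) -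
      (∫ U, Real.exp (S (emb U)) * u (emb U) ∂(haarPi ι N)) *
        (∫ U, Real.exp (S (emb U)) * v (emb U) ∂(haarPi ι N)) with hCu
  have hCu_le : K * |Cu| ≤ Z * (Real.sqrt Z * (Real.exp (-(κ * m)) * ∑ e, δu e) * (Real.sqrt Z * ∑ e, δv e)) := by
    refine hmain.trans (mul_le_mul_of_nonneg_left ?_ hZpos.le)
    exact mul_le_mul hsqu hsqv (Real.sqrt_nonneg _) (mul_nonneg (Real.sqrt_nonneg _) (by positivity))
  have hZZ : Real.sqrt Z * Real.sqrt Z = Z := Real.mul_self_sqrt hZpos.le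
  have hexp : Real.exp (-(κ * m)) = Real.exp (-κ * m) := by rw [neg_mul]
  have key : K * |Cu| ≤ Z ^ 2 * (Real.exp (-κ * m) * (∑ e, δu e) * (∑ e, δv e)) := by
    calc K * |Cu| ≤ Z * (Real.sqrt Z * (Real.exp (-(κ * m)) * ∑ e, δu e) * (Real.sqrt Z * ∑ e, δv e)) := hCu_le
      _ = Z ^ 2 * (Real.exp (-κ * m) * (∑ e, δu e) * (∑ e, δv e)) := by
          rw [hexp, show Z * (Real.sqrt Z * (Real.exp (-κ * m) * ∑ e, δu e) * (Real.sqrt Z * ∑ e, δv e)) =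
            Z * (Real.sqrt Z * Real.sqrt Z) * (Real.exp (-κ * m) * (∑ e, δu e) * (∑ e, δv e)) by ring, hZZ]
          ring
  rw [le_div_iff₀ hK, mul_comm]
  exact key

end QuasiLocal

section QuasiLocalDoor

variable {d N : ℕ} {L : ℕ} [NeZero L]

/-- ★★ **THE QUASI-LOCAL DOOR on the torus (un-normalised).**  `S = wilsonPot β + R`, `R` polynomial with `HessBound R Λ_R`
and an ANY-RANGE off-diagonal profile `h_R ≥ 0` (symmetric); `D` 1-Lipschitz along Wilson neighbours ONLY; `κ ≥ 0`;
`Θ_R ≥ Σ_{e'} h_R e e'·(e^{κ|D e − D e'|} − 1)` (the remainder's profile constant at rate `κ`);  DOOR CONDITION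
`K := N/2 − (N|β|Λ₀ + Λ_R) − (H_W⁺·(e^κ − 1) + Θ_R) > 0`, `H_W⁺ = max(6(d−1)N|β|, 0)`.  Then
`|Z ∫ e^S uv − ∫ e^S u ∫ e^S v| ≤ Z²·e^{−κ m}(Σδu)(Σδv)/K`.  As `κ → 0` the condition tends to the finite-range window
`N/2 − (N|β|Λ₀ + Λ_R) > 0` of §2 (same depth, slower rate). [folklore] -/
theorem beDoorQL_abs_le {Λ₀ : ℝ} (hH : WilsonHessianBound d N Λ₀) (hN : N ≠ 0) (β : ℝ) (hL : 1 < L)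
    {R : Cfg (Edge d L) N → ℝ} {dR : ℕ} (hRp : R ∈ polySpace (Edge d L) N dR)
    {ΛR : ℝ} (hRH : HessBound R ΛR) {hR : Edge d L → Edge d L → ℝ} (hRO : OffDiagHessBound R hR)
    (hR0 : ∀ e e', 0 ≤ hR e e') (hRsymm : ∀ e e', hR e e' = hR e' e)
    (D : Edge d L → ℕ) (hD : ∀ e e', e' ∈ linkNbrT e → D e ≤ D e' + 1) {κ ΘR : ℝ} (hκ : 0 ≤ κ)
    (hΘR : ∀ e, ∑ e', hR e e' * (Real.exp (κ * |(D e : ℝ) - D e'|) - 1) ≤ ΘR)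
    (hK : 0 < (N : ℝ) / 2 - ((N : ℝ) * |β| * Λ₀ + ΛR) -
      (max (6 * ((d : ℝ) - 1) * N * |β|) 0 * (Real.exp κ - 1) + ΘR))
    {u v : Cfg (Edge d L) N → ℝ} (hu : ContDiff ℝ ∞ u) (hv : ContDiff ℝ ∞ v)
    {δu δv : Edge d L → ℝ} (hδu : ∀ e, 0 ≤ δu e) (hδv : ∀ e, 0 ≤ δv e)
    (hLu : LinkLipschitz u δu) (hLv : LinkLipschitz v δv)
    (hDv : ∀ e, δv e ≠ 0 → D e = 0) {m : ℕ} (hDu : ∀ e, δu e ≠ 0 → m ≤ D e) :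
    |(∫ x : PSU (Edge d L) N, Real.exp ((wilsonPot d N L β + R) (emb x)) ∂(haarPi (Edge d L) N)) *
          (∫ x : PSU (Edge d L) N, Real.exp ((wilsonPot d N L β + R) (emb x)) * (u (emb x) * v (emb x))
            ∂(haarPi (Edge d L) N)) -
        (∫ x : PSU (Edge d L) N, Real.exp ((wilsonPot d N L β + R) (emb x)) * u (emb x) ∂(haarPi (Edge d L) N)) *
          (∫ x : PSU (Edge d L) N, Real.exp ((wilsonPot d N L β + R) (emb x)) * v (emb x) ∂(haarPi (Edge d L) N))|
      ≤ (∫ x : PSU (Edge d L) N, Real.exp ((wilsonPot d N L β + R) (emb x)) ∂(haarPi (Edge d L) N)) ^ 2 *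
          (Real.exp (-κ * m) * (∑ e, δu e) * (∑ e, δv e)) /
        ((N : ℝ) / 2 - ((N : ℝ) * |β| * Λ₀ + ΛR) - (max (6 * ((d : ℝ) - 1) * N * |β|) 0 * (Real.exp κ - 1) + ΘR)) := by
  have hSp : wilsonPot d N L β + R ∈ polySpace (Edge d L) N (max 4 dR) :=
    Submodule.add_mem _ (polySpace_mono (le_max_left 4 dR) (wilsonPot_mem_polySpace (d := d) (N := N) (L := L) β))
      (polySpace_mono (le_max_right 4 dR) hRp)
  have hHess : HessBound (wilsonPot d N L β + R) ((N : ℝ) * |β| * Λ₀ + ΛR) :=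
    hessBound_add (contDiff_wilsonPot β) (contDiff_of_mem_polySpace hRp) (hessBound_wilsonPot hH β) hRH
  have hOff : OffDiagHessBound (wilsonPot d N L β + R) (wilsonH d N L β + hR) :=
    offDiagHessBound_add (contDiff_wilsonPot β) (contDiff_of_mem_polySpace hRp) (offDiagHessBound_wilsonPot hL β) hRO
  have hh0 : ∀ e e', 0 ≤ (wilsonH d N L β + hR) e e' := fun e e' => by
    simp only [Pi.add_apply]; exact add_nonneg (wilsonH_nonneg N β e e') (hR0 e e')
  have hsymm : ∀ e e', (wilsonH d N L β + hR) e e' = (wilsonH d N L β + hR) e' e := fun e e' => by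
    simp only [Pi.add_apply]; rw [wilsonH_symm N β e e', hRsymm e e']
  have hκ1 : 0 ≤ Real.exp κ - 1 := by linarith [Real.one_le_exp hκ]
  -- Wilson part of the profile: neighbours are at `D`-distance ≤ 1
  have hWpt : ∀ e e', wilsonH d N L β e e' * (Real.exp (κ * |(D e : ℝ) - D e'|) - 1) ≤
      wilsonH d N L β e e' * (Real.exp κ - 1) := fun e e' => by
    by_cases hw : wilsonH d N L β e e' = 0
    · rw [hw, zero_mul, zero_mul]
    refine mul_le_mul_of_nonneg_left ?_ (wilsonH_nonneg N β e e')
    have h1 : D e ≤ D e' + 1 := hD e e' (mem_linkNbrT_of_wilsonH_ne_zero N hw)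
    have h2 : D e' ≤ D e + 1 := hD e' e (mem_linkNbrT_of_wilsonH_ne_zero N (by rwa [wilsonH_symm N β e' e]))
    have h3 : |(D e : ℝ) - D e'| ≤ 1 := by
      rw [abs_le]; constructor
      · have : (D e' : ℝ) ≤ D e + 1 := by exact_mod_cast h2
        linarith
      · have : (D e : ℝ) ≤ D e' + 1 := by exact_mod_cast h1
        linarith
    have h4 : κ * |(D e : ℝ) - D e'| ≤ κ := by nlinarith [abs_nonneg ((D e : ℝ) - D e')]
    linarith [Real.exp_le_exp.2 h4]
  have hΘ : ∀ e, ∑ e', (wilsonH d N L β + hR) e e' * (Real.exp (κ * |(D e : ℝ) - D e'|) - 1) ≤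
      max (6 * ((d : ℝ) - 1) * N * |β|) 0 * (Real.exp κ - 1) + ΘR := fun e => by
    simp only [Pi.add_apply, add_mul]
    rw [Finset.sum_add_distrib]
    refine add_le_add ?_ (hΘR e)
    calc ∑ e', wilsonH d N L β e e' * (Real.exp (κ * |(D e : ℝ) - D e'|) - 1)
        ≤ ∑ e', wilsonH d N L β e e' * (Real.exp κ - 1) := sum_le_sum fun e' _ => hWpt e e'
      _ = (∑ e', wilsonH d N L β e e') * (Real.exp κ - 1) := by rw [sum_mul]
      _ ≤ max (6 * ((d : ℝ) - 1) * N * |β|) 0 * (Real.exp κ - 1) :=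
          mul_le_mul_of_nonneg_right ((sum_wilsonH_le N β e).trans (le_max_left _ _)) hκ1
  have hK' : 0 < (N : ℝ) / 2 - ((N : ℝ) * |β| * Λ₀ + ΛR) -
      (max (6 * ((d : ℝ) - 1) * N * |β|) 0 * (Real.exp κ - 1) + ΘR) := hK
  exact cov_decay_quasilocal hN hSp hHess hOff hh0 hsymm D hκ hΘ hK' hu hv hδu hδv hLu hLv hDv hDu

/-- ★★ **THE QUASI-LOCAL DOOR (normalised form)**: `|Cov_{Z⁻¹e^S}(u,v)| ≤ e^{−κ m}(Σδu)(Σδv)/K` under the hypotheses of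
`beDoorQL_abs_le` — ONE constant for every torus side `L ≥ 2` and every polynomial quasi-local remainder in the door. [folklore] -/
theorem beDoorQL_gibbsCov_le {Λ₀ : ℝ} (hH : WilsonHessianBound d N Λ₀) (hN : N ≠ 0) (β : ℝ) (hL : 1 < L)
    {R : Cfg (Edge d L) N → ℝ} {dR : ℕ} (hRp : R ∈ polySpace (Edge d L) N dR)
    {ΛR : ℝ} (hRH : HessBound R ΛR) {hR : Edge d L → Edge d L → ℝ} (hRO : OffDiagHessBound R hR)
    (hR0 : ∀ e e', 0 ≤ hR e e') (hRsymm : ∀ e e', hR e e' = hR e' e)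
    (D : Edge d L → ℕ) (hD : ∀ e e', e' ∈ linkNbrT e → D e ≤ D e' + 1) {κ ΘR : ℝ} (hκ : 0 ≤ κ)
    (hΘR : ∀ e, ∑ e', hR e e' * (Real.exp (κ * |(D e : ℝ) - D e'|) - 1) ≤ ΘR)
    (hK : 0 < (N : ℝ) / 2 - ((N : ℝ) * |β| * Λ₀ + ΛR) -
      (max (6 * ((d : ℝ) - 1) * N * |β|) 0 * (Real.exp κ - 1) + ΘR))
    {u v : Cfg (Edge d L) N → ℝ} (hu : ContDiff ℝ ∞ u) (hv : ContDiff ℝ ∞ v)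
    {δu δv : Edge d L → ℝ} (hδu : ∀ e, 0 ≤ δu e) (hδv : ∀ e, 0 ≤ δv e)
    (hLu : LinkLipschitz u δu) (hLv : LinkLipschitz v δv)
    (hDv : ∀ e, δv e ≠ 0 → D e = 0) {m : ℕ} (hDu : ∀ e, δu e ≠ 0 → m ≤ D e) :
    |gibbsCov (wilsonPot d N L β + R) u v| ≤
      Real.exp (-κ * m) * (∑ e, δu e) * (∑ e, δv e) /
        ((N : ℝ) / 2 - ((N : ℝ) * |β| * Λ₀ + ΛR) - (max (6 * ((d : ℝ) - 1) * N * |β|) 0 * (Real.exp κ - 1) + ΘR)) := by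
  have hmain := beDoorQL_abs_le hH hN β hL hRp hRH hRO hR0 hRsymm D hD hκ hΘR hK hu hv hδu hδv hLu hLv hDv hDu
  set S := wilsonPot d N L β + R with hS
  have hSc : Continuous fun U : PSU (Edge d L) N => S (emb U) :=
    continuous_restrict ((contDiff_wilsonPot β).add (contDiff_of_mem_polySpace hRp))
  set Z : ℝ := ∫ U, Real.exp (S (emb U)) ∂(haarPi (Edge d L) N) with hZ
  have hZpos : 0 < Z := integral_exp_pos (integrable_of_continuous_PSU (Real.continuous_exp.comp hSc) _)
  rw [gibbsCov, gibbsCov_eq_div hZpos.ne', abs_div, abs_of_pos (pow_pos hZpos 2), div_le_iff₀ (pow_pos hZpos 2)]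
  refine hmain.trans (le_of_eq ?_)
  ring

/-- NUMBERS (SU(2), `d = 4`, `Λ₀ = 16`, `β ≥ 0`, `β_W = 4β`): the quasi-local door condition reads
`32β + 36β(e^κ − 1) + Λ_R + Θ_R(κ) < 1`, i.e. `β_W,eff·(8 + 9(e^κ − 1)) + Λ_R + Θ_R(κ) < 1`; at `κ → 0` it is the §3 window
`8β_W + Λ_R < 1`. [folklore] -/
theorem beDoorQL_window_su2_d4 {β ΛR ΘR κ : ℝ} (hβ : 0 ≤ β) :
    0 < (2 : ℝ) / 2 - ((2 : ℝ) * |β| * (4 * (4 : ℕ)) + ΛR) -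
        (max (6 * (((4 : ℕ) : ℝ) - 1) * (2 : ℕ) * |β|) 0 * (Real.exp κ - 1) + ΘR) ↔
      32 * β + 36 * β * (Real.exp κ - 1) + ΛR + ΘR < 1 := by
  rw [abs_of_nonneg hβ]
  have h36 : max (6 * (((4 : ℕ) : ℝ) - 1) * (2 : ℕ) * β) 0 = 36 * β := by
    rw [max_eq_left] <;> push_cast <;> nlinarith
  rw [h36]
  push_cast
  constructor <;> intro h <;> nlinarith

end QuasiLocalDoor

end Summit.Ventures.YMGap.BEDoor
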